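import Summits.AtomisticToContinuum.Crystallization.Theorems.FrustratedLawDichotomyCornerPairing

/-!
# FrustratedLawDichotomy · crux `AperiodicFrustratedLawGap` (stmt-AtomisticToContinuum-27623) — CORNER PAIRING II: the HALF-CAP at a
# path-type corner (decomp-a2c, prover hand 2, gen 9)

Continuation of `FrustratedLawDichotomyCornerPairing` (p821792).  Setting: `LinkIso θ Pat y i τ`, a link vertex `τ w` whose own link is
hcp-classified (`LinkIso θ hcpKissingPattern y (τ w) τ'`, `τ' w' = i`), and two contacts `a, b₂` of `w` forming — at a PATH-TYPE corner `w`
(a `3².4²` corner: some contact `b` of `w` has degree `2` inside `C(w)`) — the isolated-vertex/end pair (degree sum `1`; in the hcp pattern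
this is exactly a DIAGONAL pair of the link of `i`, `hcpInt_diagonal_iff_degree_sum_one_of_pathType`).  By CORNER PAIRING I the partners
`a', b₂'` are a diagonal pair of the neighbour's pattern; a diagonal pair of the hcp pattern has exactly two common contacts
(`hcpInt_card_common_contacts_of_diagonal`, p821347), one of which is `w'`; the other, `x' ≠ w'`, indexes a site

  `m := τ' x'` with `m ∼ τ a`, `m ∼ τ b₂`, `m ∼ τ w`, `m ≠ i`, `m ∉ range τ`

— the **half-cap** of the square `{a, w, b₂, ·}` seen from the corner `w` (`exists_halfCap_of_pathType_corner`).  (The full cap of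
`Capped` needs `m ∼ τ w''` for the opposite corner `w''` too: at a second path-type corner the same construction gives a half-cap `m''`, and
`m = m''` is the metric «cap-match» step; at matching-type corners the twisted pairing must first be excluded metrically — lens-5 NODE §4.)
`[folklore]`; def-free; no `sorry`.
-/

noncomputable section

namespace Summit.AtomisticToContinuum.Crystallization.Theorems.FrustratedLawDichotomyCornerPairingHalfCap

open Literature.Geometry.DiscreteGeometry
open Summit.AtomisticToContinuum.Crystallization.Theorems.FrustratedLawDichotomyTwoShellRigidityCut (E3 LinkIso)
open Summit.AtomisticToContinuum.Crystallization.Theorems.FrustratedLawDichotomyLinkIsoToolkit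
  (neighborSet_eq_range injective_of_linkIso)
open Summit.AtomisticToContinuum.Crystallization.Theorems.FrustratedLawDichotomyCappedRigidityCertPatterns
  (dist_eq_sqrt_two_iff_sqNormInt hcp_contactSeparating)
open Summit.AtomisticToContinuum.Crystallization.Theorems.FrustratedLawDichotomyCornerPairing
  (exists_partner diagonal_partners_of_pathType_hcp ncard_common_contacts_scaledPattern exists_int_of_mem_scaledPattern)

variable {θ : ℝ} {Pat : Finset E3} {N : ℕ} {y : Fin N → E3} {i : Fin N} {τ : ↥Pat → Fin N}

set_option maxRecDepth 8000 in
/-- hcp (integer model, cast form): a diagonal pair has exactly two common contacts. [folklore] -/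
theorem hcpInt_card_common_contacts_of_diagonal' : ∀ v ∈ hcpInt, ∀ w ∈ hcpInt, sqNormInt (v - w) = 2 * ((18 : ℕ) : ℤ) →
    (hcpInt.filter (fun z => sqNormInt (v - z) = ((18 : ℕ) : ℤ) ∧ sqNormInt (w - z) = ((18 : ℕ) : ℤ))).card = 2 := by
  decide

/-- **hcp: a diagonal pair of the hcp kissing pattern has exactly two common contacts.** [folklore] -/
theorem hcp_ncard_common_contacts_of_diagonal (u a : ↥hcpKissingPattern) (h : dist (u : E3) (a : E3) = Real.sqrt 2) :
    ({c : ↥hcpKissingPattern | dist (u : E3) (c : E3) = 1} ∩ {c : ↥hcpKissingPattern | dist (a : E3) (c : E3) = 1}).ncard = 2 := by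
  have h18 : (18 : ℕ) ≠ 0 := by norm_num
  obtain ⟨v₀, hv₀, hv⟩ := exists_int_of_mem_scaledPattern u
  obtain ⟨z₀, hz₀, hz⟩ := exists_int_of_mem_scaledPattern a
  have hd : sqNormInt (v₀ - z₀) = 2 * ((18 : ℕ) : ℤ) := by
    rw [← hv, ← hz] at h
    exact (dist_eq_sqrt_two_iff_sqNormInt h18 v₀ z₀).1 h
  have key := hcpInt_card_common_contacts_of_diagonal' v₀ hv₀ z₀ hz₀ hd
  rw [← ncard_common_contacts_scaledPattern h18 u a hv hz] at key
  exact key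

/-- **THE HALF-CAP AT A PATH-TYPE CORNER.**  `LinkIso θ Pat y i τ`; the neighbour `τ w` hcp-classified via `τ'` with `τ' w' = i`; `a, b₂`
distinct contacts of `w` with degree sum `1` inside `C(w)`, and `w` path-type (a contact `b` of degree `2`).  Then some site `m` is
θ-bonded to `τ a`, `τ b₂` and `τ w`, is not the centre and is not a link vertex of `i`. [folklore] -/
theorem exists_halfCap_of_pathType_corner {τ' : ↥hcpKissingPattern → Fin N} (hτ : Function.Injective τ)
    (hL : LinkIso θ Pat y i τ) (w : ↥Pat) (hL' : LinkIso θ hcpKissingPattern y (τ w) τ') {w' : ↥hcpKissingPattern} (hw' : τ' w' = i)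
    {a b b₂ : ↥Pat} (ha : dist (w : E3) (a : E3) = 1) (hb : dist (w : E3) (b : E3) = 1) (hb₂ : dist (w : E3) (b₂ : E3) = 1)
    (hab₂ : a ≠ b₂)
    (hdeg2 : ({c : ↥Pat | dist (w : E3) (c : E3) = 1} ∩ {c : ↥Pat | dist (b : E3) (c : E3) = 1}).ncard = 2)
    (hsum : ({c : ↥Pat | dist (w : E3) (c : E3) = 1} ∩ {c : ↥Pat | dist (a : E3) (c : E3) = 1}).ncard +
      ({c : ↥Pat | dist (w : E3) (c : E3) = 1} ∩ {c : ↥Pat | dist (b₂ : E3) (c : E3) = 1}).ncard = 1) :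
    ∃ m : Fin N, m ≠ i ∧ (bondGraph θ y).Adj m (τ a) ∧ (bondGraph θ y).Adj m (τ b₂) ∧ (bondGraph θ y).Adj m (τ w) ∧
      m ∉ Set.range τ := by
  have hτ' : Function.Injective τ' := injective_of_linkIso hcp_contactSeparating hL'
  -- partners and the diagonal pair on the neighbour's side
  obtain ⟨a', ha'w, ha', -⟩ := exists_partner hτ' hL w hL' hw' ha
  obtain ⟨c', hc'w, hc', -⟩ := exists_partner hτ' hL w hL' hw' hb₂
  have hdiag : dist (a' : E3) (c' : E3) = Real.sqrt 2 :=
    diagonal_partners_of_pathType_hcp hτ hτ' hL w hL' hw' ha hb hb₂ hab₂ hdeg2 hsum ha' hc'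
  -- the two common contacts of {a', c'}: w' and some x' ≠ w'
  have h2 := hcp_ncard_common_contacts_of_diagonal a' c' hdiag
  obtain ⟨x₁, x₂, hne, hS⟩ := Set.ncard_eq_two.1 h2
  have hw'mem : w' ∈ ({c : ↥hcpKissingPattern | dist (a' : E3) (c : E3) = 1} ∩
      {c : ↥hcpKissingPattern | dist (c' : E3) (c : E3) = 1}) := by
    refine ⟨?_, ?_⟩
    · show dist (a' : E3) (w' : E3) = 1
      rw [dist_comm]; exact ha'w
    · show dist (c' : E3) (w' : E3) = 1
      rw [dist_comm]; exact hc'w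
  obtain ⟨x', hx'mem, hx'ne⟩ : ∃ x', x' ∈ ({c : ↥hcpKissingPattern | dist (a' : E3) (c : E3) = 1} ∩
      {c : ↥hcpKissingPattern | dist (c' : E3) (c : E3) = 1}) ∧ x' ≠ w' := by
    rw [hS] at hw'mem ⊢
    simp only [Set.mem_insert_iff, Set.mem_singleton_iff] at hw'mem
    rcases hw'mem with h | h
    · exact ⟨x₂, by simp, fun e => hne (h.symm.trans e.symm)⟩
    · exact ⟨x₁, by simp, fun e => hne (e.trans h)⟩
  obtain ⟨hx'a, hx'c⟩ := hx'mem
  refine ⟨τ' x', ?_, ?_, ?_, ?_, ?_⟩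
  · -- not the centre
    intro h
    exact hx'ne (hτ' (h.trans hw'.symm))
  · -- bonded to τ a = τ' a'
    rw [← ha']
    exact ((hL'.2.2 x' a').2 (by rw [dist_comm]; exact hx'a))
  · -- bonded to τ b₂ = τ' c'
    rw [← hc']
    exact ((hL'.2.2 x' c').2 (by rw [dist_comm]; exact hx'c))
  · -- bonded to τ w (it is a link vertex of τ w)
    exact (hL'.1 x').symm
  · -- not a link vertex of i: a link vertex τ z bonded to τ a and τ b₂ would make z a common contact of a, b₂ AND of w … but it is also
    -- bonded to τ w, so dist z w = 1, and then z ∈ C(w) ∩ C(a) ∩ C(b₂); degree sum 1 forbids a common contact of a and b₂ inside C(w).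
    rintro ⟨z, hz⟩
    have hza : dist (z : E3) (a : E3) = 1 := by
      have := (hL'.2.2 x' a').2 (by rw [dist_comm]; exact hx'a)
      rw [hz.symm, ha'] at this
      exact (hL.2.2 z a).1 this
    have hzb : dist (z : E3) (b₂ : E3) = 1 := by
      have := (hL'.2.2 x' c').2 (by rw [dist_comm]; exact hx'c)
      rw [hz.symm, hc'] at this
      exact (hL.2.2 z b₂).1 this
    have hzw : dist (w : E3) (z : E3) = 1 := by
      have := (hL'.1 x').symm
      rw [hz.symm] at this
      rw [dist_comm]
      exact (hL.2.2 z w).1 this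
    -- z lies in both C(w) ∩ C(a) and C(w) ∩ C(b₂): each has ncard ≥ 1, contradicting degree sum 1
    have h1 : 1 ≤ ({c : ↥Pat | dist (w : E3) (c : E3) = 1} ∩ {c : ↥Pat | dist (a : E3) (c : E3) = 1}).ncard := by
      rw [Nat.one_le_iff_ne_zero]
      intro h0
      have hfin : ({c : ↥Pat | dist (w : E3) (c : E3) = 1} ∩ {c : ↥Pat | dist (a : E3) (c : E3) = 1}).Finite :=
        Set.toFinite _
      have := (Set.ncard_eq_zero hfin).1 h0
      have hzmem : z ∈ ({c : ↥Pat | dist (w : E3) (c : E3) = 1} ∩ {c : ↥Pat | dist (a : E3) (c : E3) = 1}) :=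
        ⟨hzw, by show dist (a : E3) (z : E3) = 1; rw [dist_comm]; exact hza⟩
      rw [this] at hzmem
      exact hzmem
    have h2' : 1 ≤ ({c : ↥Pat | dist (w : E3) (c : E3) = 1} ∩ {c : ↥Pat | dist (b₂ : E3) (c : E3) = 1}).ncard := by
      rw [Nat.one_le_iff_ne_zero]
      intro h0
      have hfin : ({c : ↥Pat | dist (w : E3) (c : E3) = 1} ∩ {c : ↥Pat | dist (b₂ : E3) (c : E3) = 1}).Finite :=
        Set.toFinite _
      have := (Set.ncard_eq_zero hfin).1 h0
      have hzmem : z ∈ ({c : ↥Pat | dist (w : E3) (c : E3) = 1} ∩ {c : ↥Pat | dist (b₂ : E3) (c : E3) = 1}) :=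
        ⟨hzw, by show dist (b₂ : E3) (z : E3) = 1; rw [dist_comm]; exact hzb⟩
      rw [this] at hzmem
      exact hzmem
    omega

end Summit.AtomisticToContinuum.Crystallization.Theorems.FrustratedLawDichotomyCornerPairingHalfCap

end
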